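import Summits.BirchSwinnertonDyer.BirchSwinnertonDyer.Theorems.AdditiveBranchIMCGenusKolyvaginNonsplitSignReceptacle
import HarnessLib

/-!
# Registered stub `stub_nonsplitFrobeniusSign` of line `three_field_road` v13 — PROVED, BY NAME AND SIGNATURE
# (crux `AdditiveBranchIMC.GordTwoRankZeroOffCaseOne`, stmt-BirchSwinnertonDyer-19357, route K1 `AdditiveBranchIMC`;
# LEAD `cruxlead-stmt-BirchSwinnertonDyer-19357` g3; `--supports stmt-BirchSwinnertonDyer-19357`)

HONEST FRAMING. One theorem; no definition; no named fact; no `sorry`; BSD is proved for no curve by this file, and the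
crux item stays OPEN (three other registered stubs of the line remain: residual [by design], printedFacts [cite-only],
tameJointLower [sibling line]). The registered stub (skeleton v13, `Cruxes/GordTwoRankZeroOffCaseOne/Lines/three_field_road.lean`,
`ledger skeleton check` 9ea8cdc0e9b9 (v13 of record 3b0d486a3202)) — VERBATIM: L2, the Kodaira–Néron–Tate SIGN at a NON-SPLIT multiplicative place — for `X/K`
elliptic over a number field, `v` of multiplicative, not split multiplicative reduction, `𝔐 ∈ v.localPrimesAbove`, an
arithmetic Frobenius `F` at `𝔐`, and every `I_𝔐`-fixed `Q ∈ X(K̄_v)`: `F • Q + Q ∈ X11b.E0Receptacle X v` (Frobenius acts as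
`−1` on `X(K_v^nr)/X⁰(K_v^nr) ≅ Φ_v(k̄_v)`; Silverman *ATAEC* Cor. IV.9.2 (d), Thm. IV.9.4 Step 2; *AEC* Thm. C.15.2).

PROOF. `GenusKolyvagin.NonsplitSign.frobenius_smul_add_mem_E0Receptacle_of_not_hasSplitMultiplicativeReductionAt`
(`Theorems/AdditiveBranchIMCGenusKolyvaginNonsplitSignReceptacle.lean`), which has exactly this statement: the sign theorem on
the non-split normal form (`…NonsplitSign.lean`: good points by the Galois stability of `E₀`, bad points by the coordinate core
`hasNonsingularReduction_add_conj`, p681179, over the unramified integers with the Frobenius swapping the Hensel slopes,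
tools p684568) transported to the receptacle.

References (locators only): [cite: SilvermanATAEC1994, Cor. IV.9.2 (d), Thm. IV.9.4 Step 2] [cite: SilvermanAEC2009, App. C
Thm. 15.2] [cite: McCallumLMS1991, Lemma 4.3 (proof)]. presearch: n/a (assembly of tree theorems; no new mathematics).
Axioms: `propext`, `Classical.choice`, `Quot.sound`.
-/

set_option autoImplicit false
-- D-0017: single-problem summit, so `Summit.BirchSwinnertonDyer.BirchSwinnertonDyer.…` repeats a namespace BY DESIGN.
set_option linter.dupNamespace false

noncomputable section

open scoped Classical

namespace Summit.BirchSwinnertonDyer.BirchSwinnertonDyer.Theorems.AdditiveBranchIMCThreeFieldRoad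

open NumberField IsDedekindDomain
open WeierstrassCurve Literature.NumberTheory.EllipticCurves
open Summit.BirchSwinnertonDyer.Rank1Residual
open Summit.BirchSwinnertonDyer.BirchSwinnertonDyer.Theorems

/-- **Registered stub `stub_nonsplitFrobeniusSign` of line `three_field_road` v13** (crux `GordTwoRankZeroOffCaseOne`, stmt-BirchSwinnertonDyer-19357), BY NAME AND
SIGNATURE — at a non-split multiplicative place the arithmetic Frobenius acts as `−1` on `X(K_v^nr)/X⁰(K_v^nr)`: for every
inertia-fixed `Q ∈ X(K̄_v)`, `F • Q + Q ∈ E⁰(K̄_v) = X11b.E0Receptacle X v`. One application of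
`GenusKolyvagin.NonsplitSign.frobenius_smul_add_mem_E0Receptacle_of_not_hasSplitMultiplicativeReductionAt`.
[cite: SilvermanATAEC1994, Cor. IV.9.2 (d), Thm. IV.9.4 Step 2] [cite: SilvermanAEC2009, App. C Thm. 15.2] -/
theorem stub_nonsplitFrobeniusSign :
    ∀ (K : Type) [Field K] [NumberField K] (X : WeierstrassCurve K) [X.IsElliptic]
      (v : HeightOneSpectrum (𝓞 K)),
      X.HasMultiplicativeReductionAt v → ¬ X.HasSplitMultiplicativeReductionAt v →
      ∀ 𝔐 ∈ v.localPrimesAbove, ∀ F : Field.absoluteGaloisGroup (v.adicCompletion K),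
        IsArithFrobAt (v.adicCompletionIntegers K) F 𝔐 →
        ∀ Q : localPoints X (v.adicCompletion K),
          (∀ σ ∈ 𝔐.inertia (Field.absoluteGaloisGroup (v.adicCompletion K)), σ • Q = Q) →
            F • Q + Q ∈ X11b.E0Receptacle X v :=
  fun K _ _ X _ v hmult hns 𝔐 h𝔐 F hF Q hQ =>
    GenusKolyvagin.NonsplitSign.frobenius_smul_add_mem_E0Receptacle_of_not_hasSplitMultiplicativeReductionAt
      K X v hmult hns 𝔐 h𝔐 F hF Q hQ

end Summit.BirchSwinnertonDyer.BirchSwinnertonDyer.Theorems.AdditiveBranchIMCThreeFieldRoad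

end
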